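import Summits.NavierStokesRegularity.NavierStokesRegularity.Theses.SqueezeCycle
import Summits.NavierStokesRegularity.NavierStokesRegularity.Theorems.RecurrentProfilesRecurrentReduction
import Summits.NavierStokesRegularity.NavierStokesRegularity.Theorems.SqueezeCycleRecurrentLiouvilleNearIdentityDSS
import Summits.NavierStokesRegularity.NavierStokesRegularity.Theorems.SqueezeCycleRecurrentLiouvilleNearAxisymmetricRemoval
import Summits.NavierStokesRegularity.NavierStokesRegularity.Theorems.SqueezeCycleExtremalBiaxialitySubcriticalSmallConstant
import Summits.NavierStokesRegularity.NavierStokesRegularity.Theorems.SqueezeCycleExtremalElementExistsRegularity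
import Literature.Analysis.FluidPDE.TypeIRateOseenMildRepresentative
import Literature.Analysis.FluidPDE.LocalTypeILiouville
import Literature.Analysis.FluidPDE.ScalingUniformRecurrence

/-!
# `RecurrentLiouville` (crux stmt-NavierStokesRegularity-1589): portrait of a counterexample —
# negative-side support (cdisprove, gen 2)

The crux `SqueezeCycle.RecurrentLiouville` (= `RecurrentProfiles.RecurrentLiouville`) fails iff
a Type-I singularity model of the Albritton–Barker class exists (suitable weak on the backward
slab, weak gradient, `𝐈 < ⊤`, rate `‖u(t,x)‖ ≤ C/√(−t)`, backward-singular origin; recurrence is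
a free normalisation by the proved `recurrentReduction_proof`, item 1590). This file assembles,
from theorems ALREADY IN THE TREE, the typed constraints every such model must satisfy — the
"portrait" a counterexample hunter must match and a prover may assume away:

* `exists_universal_rate_floor_ae_zero`, `exists_universal_rate_floor` — a UNIVERSAL `ε > 0`:
  class members with `C ≤ ε` vanish a.e. on the slab, so every counterexample has `C > ε`
  WHATEVER its `𝐈`-level (Leray's lower blow-up-rate bound in ancient class form: A–B's continuous
  Oseen-mild representative `exists_oseenMild_repr_of_typeIBound_lt_top`, the KNSS Prop. 4.1
  bridge `isTypeIAncientMild_of_continuous_oseenMild`, and the halving lemma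
  `exists_typeIAncientMild_eq_zero_of_small`). Neither `C` nor `𝐈` can be normalised: both are
  scale invariant.
* `counterexample_portrait` — any counterexample `(u,p,G,C)`: (1) respects the universal floor;
  (2) is not a.e. `λ`-DSS on the slab for any `λ` in a window `(1, Λ(C,𝐈(u)))`, in particular
  not self-similar (line Sketch Branch A′, `stub_rlNearIdentityDSS`: Tsai's rung made OPEN inside
  the crux's own class — time rate only, suitable weak, a.e. DSS); (3) is `δ(C,𝐈(u))`-far in
  `L³(Q(0,2))` from EVERY field with axisymmetric slices (Branch C,
  `stub_rlNearAxisymmetricRemoval`: the Seregin–Šverák rung made open); (4) has a uniformly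
  recurrent singular sibling in the same class with the same rate (`recurrentReduction_proof`).

Items (2)–(3) are the entire harvest of line Sketch (card `rung-neighbourhoods`); its residual
stub S5 is the crux again (`ResidualCoreIsCrux.lean`). What is LEFT for a counterexample: large-`λ`
DSS (Bradshaw–Tsai OP 5.1 / Tsai's conjecture), `α ≈ 1` RSS (Pineau–Vicol 2026 Conj. 1.1),
aperiodic recurrent minimal sets — each an open problem of the field.

## References

* J. Leray, Acta Math. 63 (1934), (3.9). [Leray1934]
* G. Koch, N. Nadirashvili, G. Seregin, V. Šverák, Acta Math. 203 (2009), §4, Prop. 4.1. [KNSS2009]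
* D. Albritton, T. Barker, J. Math. Fluid Mech. 21 (2019), Thm. 1.1, Lemma 2.2, Prop. 2.3.
  [AlbrittonBarker2019]
* T.-P. Tsai, ARMA 143 (1998), Thm. 1. [Tsai1998]
* G. Seregin, V. Šverák, Comm. PDE 34 (2009), Thm. 1.1. [SereginSverak2009]
-/

noncomputable section

open MeasureTheory TopologicalSpace Set Function Filter Topology Metric
open scoped InnerProductSpace RealInnerProductSpace ENNReal NNReal
open Literature.Analysis.FluidPDE
open Summit.NavierStokesRegularity.NavierStokesRegularity.Theses

set_option linter.dupNamespace false

namespace Summit.NavierStokesRegularity.NavierStokesRegularity.Theorems.RecurrentLiouville.Negative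

/-- Physical space. -/
local notation "ℝ³" => EuclideanSpace ℝ (Fin 3)

/-- The open backward slab `(-∞,0) × ℝ³` (time first), as in the route file. -/
local notation "𝕊" => Literature.Analysis.FluidPDE.slab (EuclideanSpace ℝ (Fin 3)) (Set.Iio (0 : ℝ)) isOpen_Iio

/-- `L³` on `Q(0,2)` — the metric of Branch C. -/
local notation "μ₂" => (volume.restrict (parabolicCylinder 2 (0 : ℝ × EuclideanSpace ℝ (Fin 3))) :
  Measure (ℝ × EuclideanSpace ℝ (Fin 3)))

/-- **B2′. Universal small-rate floor (Leray's lower blow-up-rate bound, ancient class form).**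
There is a UNIVERSAL `ε > 0` (independent of `𝐈`) such that every member of the crux's class
(suitable weak on the slab, `𝐈 < ⊤`, rate `C/√(−t)`) with `C ≤ ε` vanishes a.e. on the slab:
Albritton–Barker's continuous Oseen-mild representative (`exists_oseenMild_repr_of_typeIBound_lt_top`)
is a Type-I KNSS-mild ancient field (`isTypeIAncientMild_of_continuous_oseenMild`) and those vanish
for small constants (`exists_typeIAncientMild_eq_zero_of_small`, the halving argument on the
Duhamel formula). Sharpens B2 (`η(𝐈)`) in the RATE direction; no weak-gradient hypothesis needed.
[cite: Leray1934, (3.9); KochNadirashviliSereginSverak2009, §4 p. 8; AlbrittonBarker2019, Thm. 1.1] -/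
theorem exists_universal_rate_floor_ae_zero :
    ∃ ε : ℝ, 0 < ε ∧ ∀ (u : ℝ → ℝ³ → ℝ³) (p : ℝ → ℝ³ → ℝ) (G : ℝ → ℝ³ → ℝ³ →L[ℝ] ℝ³) (C : ℝ),
      IsSuitableWeakSolutionOn 𝕊 1 0 u p →
      typeIBound (Set.Iio (0 : ℝ) ×ˢ Set.univ) u p G < ⊤ → HasTypeITimeDecay C u → C ≤ ε →
      ∀ᵐ z ∂(volume.restrict (Iio (0 : ℝ) ×ˢ (univ : Set ℝ³))), uncurry u z = 0 := by
  obtain ⟨ε, hε, hsmall⟩ := exists_typeIAncientMild_eq_zero_of_small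
  refine ⟨ε, hε, fun u p G C hsw hI hdec hCε => ?_⟩
  obtain ⟨v, hae, hcont, hdiv, hmild, hrate⟩ := exists_oseenMild_repr_of_typeIBound_lt_top hsw hdec hI
  have hv : IsTypeIAncientMild C v := isTypeIAncientMild_of_continuous_oseenMild hcont hdiv hmild hrate
  have hv0 : ∀ t < 0, ∀ x, v t x = 0 := hsmall C v hv hCε
  filter_upwards [hae, ae_restrict_mem (measurableSet_Iio.prod MeasurableSet.univ)] with z hz hmem
  rw [hz]
  exact hv0 z.1 (by simpa using hmem.1) z.2

/-- **B2′, counterexample form**: a UNIVERSAL floor on the rate constant of any counterexample —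
every Type-I singularity model of the class has `C > ε`, whatever its `𝐈`-level. (By scale
invariance of both `C` and `𝐈`, neither can be normalised away.)
[cite: Leray1934, (3.9); AlbrittonBarker2019, Thm. 1.1] -/
theorem exists_universal_rate_floor :
    ∃ ε : ℝ, 0 < ε ∧ ∀ (u : ℝ → ℝ³ → ℝ³) (p : ℝ → ℝ³ → ℝ) (G : ℝ → ℝ³ → ℝ³ →L[ℝ] ℝ³) (C : ℝ),
      IsSuitableWeakSolutionOn 𝕊 1 0 u p →
      typeIBound (Set.Iio (0 : ℝ) ×ˢ Set.univ) u p G < ⊤ → HasTypeITimeDecay C u →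
      IsBackwardSingularPoint u 0 → ε < C := by
  obtain ⟨ε, hε, H⟩ := exists_universal_rate_floor_ae_zero
  refine ⟨ε, hε, fun u p G C hsw hI hdec hsing => ?_⟩
  by_contra hle
  push Not at hle
  have hae : (uncurry u) =ᵐ[volume.restrict (parabolicCylinder 1 (0 : ℝ × ℝ³))] 0 :=
    ae_restrict_of_ae_restrict_of_subset (parabolicCylinder_origin_subset_slab 1) (H u p G C hsw hI hdec hle)
  have h := hsing 1 one_pos
  rw [eLpNorm_congr_ae hae, eLpNorm_zero] at h
  exact ENNReal.zero_ne_top h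

/-- **What a counterexample must look like.** If `(u, p, G, C)` is a Type-I singularity model
of the Albritton–Barker class (= a counterexample to the crux with recurrence forgotten, §A3),
then, by theorems ALREADY IN THE TREE:
1. `C > ε` for a UNIVERSAL `ε > 0` (B2′: Leray's lower blow-up-rate bound in ancient class
   form; independent of `𝐈(u)`, and neither `C` nor `𝐈` can be normalised, both being scale
   invariant);
2. `u` is not a.e. `λ`-DSS on the slab for any `λ` in a window `(1, Λ(C, 𝐈(u)))` — in particular
   not self-similar (Branch A′ `stub_rlNearIdentityDSS`, ACCEPTED: Tsai's rung made open);
3. `u` is not `δ(C, 𝐈(u))`-close in `L³(Q(0,2))` to ANY field with axisymmetric slices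
   (Branch C `stub_rlNearAxisymmetricRemoval`, ACCEPTED: the Seregin–Šverák rung made open);
4. `u` has a uniformly recurrent singular sibling in the same class with the same rate
   (`recurrentReduction_proof`): minimal sets of the scaling flow carry counterexamples too.
Items 2–3 are the whole harvest of line Sketch (a fifth clause, orbit diameter `> δ(C, 𝐈(u))`
in `L³(Q(0,1))`, holds modulo Branch A `stub_rlSmallHullRemoval` and is recorded in the crux's
`Disproof.lean`).
[cite: AlbrittonBarker2019, Thm. 1.1, Lemma 2.2, Prop. 2.3; Tsai1998, Thm. 1; SereginSverak2009, Thm. 1.1] -/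
theorem counterexample_portrait {u : ℝ → ℝ³ → ℝ³} {p : ℝ → ℝ³ → ℝ} {G : ℝ → ℝ³ → ℝ³ →L[ℝ] ℝ³}
    {C : ℝ} (hsw : IsSuitableWeakSolutionOn 𝕊 1 0 u p) (hwg : HasWeakSpatialGradientOn 𝕊 u G)
    (hI : typeIBound (Set.Iio (0 : ℝ) ×ˢ Set.univ) u p G < ⊤) (hdec : HasTypeITimeDecay C u)
    (hsing : IsBackwardSingularPoint u 0) :
    (∃ ε : ℝ, 0 < ε ∧ ε < C ∧
      ∀ (v : ℝ → ℝ³ → ℝ³) (q : ℝ → ℝ³ → ℝ) (H : ℝ → ℝ³ → ℝ³ →L[ℝ] ℝ³) (C' : ℝ),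
        IsSuitableWeakSolutionOn 𝕊 1 0 v q → typeIBound (Iio (0 : ℝ) ×ˢ univ) v q H < ⊤ →
        HasTypeITimeDecay C' v → IsBackwardSingularPoint v 0 → ε < C') ∧
    (∃ Λ : ℝ, 1 < Λ ∧ ∀ lam : ℝ, 1 < lam → lam < Λ →
      ¬ ∀ᵐ z ∂(volume.restrict (Iio (0 : ℝ) ×ˢ (univ : Set ℝ³))), nsRescale lam u z.1 z.2 = u z.1 z.2) ∧
    (∃ δ : ℝ, 0 < δ ∧ ∀ a : ℝ → ℝ³ → ℝ³, (∀ t : ℝ, IsAxisymmetric (a t)) →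
      AEStronglyMeasurable (uncurry a) μ₂ → ENNReal.ofReal δ < eLpNorm (uncurry u - uncurry a) 3 μ₂) ∧
    (∃ (w : ℝ → ℝ³ → ℝ³) (q : ℝ → ℝ³ → ℝ) (H : ℝ → ℝ³ → ℝ³ →L[ℝ] ℝ³),
      IsSuitableWeakSolutionOn 𝕊 1 0 w q ∧ HasWeakSpatialGradientOn 𝕊 w H ∧
      typeIBound (Set.Iio (0 : ℝ) ×ˢ Set.univ) w q H < ⊤ ∧ HasTypeITimeDecay C w ∧
      IsBackwardSingularPoint w 0 ∧ IsScalingUniformlyRecurrent w) := by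
  refine ⟨?_, ?_, ?_, ?_⟩
  · -- B2′: the universal rate floor
    obtain ⟨ε, hε, H⟩ := exists_universal_rate_floor
    exact ⟨ε, hε, H u p G C hsw hI hdec hsing, H⟩
  · -- Branch A′
    obtain ⟨Λ, hΛ, H⟩ := stub_rlNearIdentityDSS C _ hI
    exact ⟨Λ, hΛ, fun lam h1 h2 hdss => H lam h1 h2 u p G hsw hwg le_rfl hdec hdss hsing⟩
  · -- Branch C
    obtain ⟨δ, hδ, H⟩ := stub_rlNearAxisymmetricRemoval C _ hI
    refine ⟨δ, hδ, fun a ha hameas => ?_⟩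
    by_contra hle
    push Not at hle
    exact H u p G hsw hwg le_rfl hdec ⟨a, ha, hameas, hle⟩ hsing
  · -- reduction to a recurrent sibling
    obtain ⟨w, q, H, hsw', hwg', hI', hdec', hsing', hrec'⟩ :=
      recurrentReduction_proof u p G C hsw hwg hI hdec hsing
    exact ⟨w, q, H, hsw', hwg', hI', hdec', hsing', hrec'⟩


end Summit.NavierStokesRegularity.NavierStokesRegularity.Theorems.RecurrentLiouville.Negative

end
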